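import Mathlib
import HarnessLib
import Literature.MathematicalPhysics.QuantumLattice.FermiRG.FSTInversion
import Literature.MathematicalPhysics.QuantumLattice.FermiRG.FST2FindCPProof
import Summits.HubbardSuperconductivity.HubbardSuperconductivity.Theorems.KLProgrammeFermiSurfaceFST2Regularity

/-!
# Route `KLProgramme` (cruxes K3/K1, risk r2): the dispersion class `𝓔(δ₀, g₀, G₀, w₀)` of the
# Feldman–Salmhofer–Trubowitz INVERSION theorem (FST IV), AS TYPED in `FermiRG/FSTInversion.lean`,
# for the Hubbard band — it EXCLUDES the Kohn–Luttinger window (umklapp) and contains the band iff `μ < -2`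

Cell `gate-hubbard-kl`, seat fs-1, risk-register item r2 «Fermi-surface hypotheses at `δ ∈ [0.10, 0.20]`».
`FermiRG/FSTInversion.lean` (typer t5) types FST IV's class `𝓔(δ₀,g₀,G₀,w₀)` of dispersion relations
(`FST4.InDispersionClass L δ₀ g₀ G₀ w₀ E`, conditions (i)–(iv) of §1.2) over lattice data
`L = (Γ#, 𝓕)` and the inversion theorem `FST4.theorem1` over that class. Condition (i) demands
`S(E) ⊂ 𝓕₂ = {p ∈ 𝓕 : 2p ∈ 𝓕}`: every point of the Fermi surface has a `Γ#`-translate `p'` in the cell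
whose DOUBLE `2p'` is still in the cell — FST IV's form of the no-umklapp restriction (A5)/(H5).

For the free Hubbard band `E = ε - μ`, `ε(p) = -2 (cos p₀ + cos p₁)`, `Γ# = 2πℤ²`, we PROVE:

* §1 **for `-2 ≤ μ < 0` condition (i) FAILS for EVERY fundamental cell `𝓕`** (any set of unique
  representatives of `ℝ²/2πℤ²`, in particular the open cell `(-π,π)²` of FST IV p.4 and the half-open cell of
  `FermiRG.Crystal.cubic 2`): the level points `q± = (±π/2, y₀)`, `cos y₀ = -μ/2`, would have cell
  representatives `q± + γ±` with `2(q± + γ±) ∈ 𝓕`, but `2(q₊ + γ₊) - 2(q₋ + γ₋) = (2π, 0) + 2(γ₊ - γ₋)` is a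
  NON-ZERO vector of `2πℤ²` (first coordinate `2π · odd`), so two distinct points of `𝓕` would be
  `Γ#`-translates (`klfs_fst4_not_subset_fund₂`, `klfs_fst4_not_inDispersionClass`; cells of record
  `klfs_fst4_not_inDispersionClass_openCell/_crystalCell`; both programme windows
  `klfs_windows_fst4_not_inDispersionClass`). So `FST4.theorem1` cannot be instantiated at the Hubbard band on
  the window for ANY constants — independently of the `C³` question recorded in DECOMP §2 C4a;
* the sequel file `KLProgrammeFermiSurfaceFSTInversionClass.lean` proves the converse half: for
  `-4 < μ < -2` the band IS in `𝓔(δ₀, g₀, G₀, w₀)` (open cell, explicit constants), its FST III norms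
  `|E|_k ≤ (k+1)² (4 + |μ|)`, the on-site interaction in `𝓥`, and «`E ∈ 𝓔` for some constants iff `μ < -2`».

No definitions; everything PROVED. [folklore]
-/

noncomputable section

open Real Set

-- the tree's namespace `Summit.<Summit>.<Problem>.Theorems` repeats the summit name by design (D-0017)
set_option linter.dupNamespace false

namespace Summit.HubbardSuperconductivity.HubbardSuperconductivity.Theorems

open Literature.MathematicalPhysics.QuantumLattice

/-! ### §0 Plumbing: coordinates of the vectors of `Γ# = 2πℤ²` -/

/-- Every vector of the dual lattice `Γ#` of `Crystal.cubic 2` has coordinates in `2πℤ`. [folklore] -/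
theorem klfs_dualLattice_coord {γ : Momentum} (hγ : γ ∈ (FermiRG.Crystal.cubic 2).dualLattice) (i : Fin 2) :
    ∃ n : ℤ, γ i = 2 * π * n := by
  change γ ∈ Submodule.span ℤ (Set.range (FermiRG.Crystal.cubicBasis 2)) at hγ
  induction hγ using Submodule.span_induction generalizing i with
  | mem x hx =>
      obtain ⟨j, rfl⟩ := hx
      rw [klfs_cubicBasis_apply]
      by_cases hij : i = j
      · subst hij
        exact ⟨1, by simp [EuclideanSpace.basisFun_apply]⟩
      · exact ⟨0, by simp [EuclideanSpace.basisFun_apply, hij]⟩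
  | zero => exact ⟨0, by simp⟩
  | add x y _ _ hx hy =>
      obtain ⟨m, hm⟩ := hx i
      obtain ⟨n, hn⟩ := hy i
      exact ⟨m + n, by rw [PiLp.add_apply, hm, hn]; push_cast; ring⟩
  | smul a x _ hx =>
      obtain ⟨m, hm⟩ := hx i
      refine ⟨a * m, ?_⟩
      rw [← Int.cast_smul_eq_zsmul ℝ, PiLp.smul_apply, hm, smul_eq_mul]
      push_cast; ring

/-- The vector with coordinates `2π nᵢ` lies in `Γ#`. [folklore] -/
theorem klfs_mem_dualLattice_of_coord (n : Fin 2 → ℤ) :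
    (WithLp.toLp 2 (fun i => 2 * π * (n i : ℝ)) : Momentum) ∈ (FermiRG.Crystal.cubic 2).dualLattice := by
  have h : (WithLp.toLp 2 (fun i => 2 * π * (n i : ℝ)) : Momentum) =
      ∑ i, (n i) • FermiRG.Crystal.cubicBasis 2 i := by
    ext j
    rw [Fin.sum_univ_two, klfs_cubicBasis_apply, klfs_cubicBasis_apply]
    fin_cases j <;>
      simp [EuclideanSpace.basisFun_apply, ← Int.cast_smul_eq_zsmul ℝ] <;> ring
  rw [h]
  exact Submodule.sum_mem _ fun i _ => Submodule.smul_mem _ _ (Submodule.subset_span ⟨i, rfl⟩)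

/-- `2π e₀ = (2π, 0) ∈ Γ#`. [folklore] -/
theorem klfs_two_pi_e0_mem_dualLattice :
    (WithLp.toLp 2 ![2 * π, 0] : Momentum) ∈ (FermiRG.Crystal.cubic 2).dualLattice := by
  have h := klfs_mem_dualLattice_of_coord ![1, 0]
  convert h using 1
  ext j; fin_cases j <;> simp

/-! ### §1 `-2 ≤ μ < 0`: condition (i) `S(E) ⊂ 𝓕₂` fails for every fundamental cell -/

/-- The two level points `q± = (±π/2, y₀)`, `y₀ = arccos(-μ/2)`, of `E = ε - μ` (`-2 ≤ μ < 0`; they are the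
momenta of the umklapp quadruple of `KLProgrammeFermiSurfaceUmklapp`). [folklore] -/
theorem klfs_fst4_halfpi_points {μ : ℝ} (hμ₁ : -2 ≤ μ) (hμ₂ : μ < 0) (s : ℝ) (hs : s = 1 ∨ s = -1) :
    squareDispersion 1 0 (WithLp.toLp 2 ![s * (π / 2), Real.arccos (-μ / 2)] : Momentum) - μ = 0 := by
  have hcos : Real.cos (Real.arccos (-μ / 2)) = -μ / 2 := Real.cos_arccos (by linarith) (by linarith)
  have hc : Real.cos (s * (π / 2)) = 0 := by
    rcases hs with rfl | rfl
    · rw [one_mul, Real.cos_pi_div_two]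
    · rw [neg_one_mul, Real.cos_neg, Real.cos_pi_div_two]
  simp [squareDispersion, hc, hcos]; ring

/-- **FST IV condition (i) fails for `-2 ≤ μ < 0`, for every fundamental cell.** Let `L = (Γ#, 𝓕)` with
`Γ# = 2πℤ²` and `𝓕` a set of UNIQUE representatives modulo `Γ#` (two points of `𝓕` differing by a lattice
vector are equal). Then `S(E) ⊄ 𝓕₂`: not every zero of `E = ε - μ` has a translate in
`𝓕₂ = {p ∈ 𝓕 : 2p ∈ 𝓕}`. [folklore] -/
theorem klfs_fst4_not_subset_fund₂ {μ : ℝ} (hμ₁ : -2 ≤ μ) (hμ₂ : μ < 0) (L : FermiRG.FST4.LatticeData 2)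
    (hL : L.latt = ((FermiRG.Crystal.cubic 2).dualLattice : Set Momentum))
    (hF : ∀ z ∈ L.fund, ∀ w ∈ L.fund, z - w ∈ L.latt → z = w) :
    ¬ ∀ p : Momentum, squareDispersion 1 0 p - μ = 0 → ∃ γ ∈ L.latt, p + γ ∈ L.fund₂ := by
  intro h
  set q₁ : Momentum := WithLp.toLp 2 ![1 * (π / 2), Real.arccos (-μ / 2)] with hq₁
  set q₂ : Momentum := WithLp.toLp 2 ![-1 * (π / 2), Real.arccos (-μ / 2)] with hq₂
  obtain ⟨γ₁, hγ₁, hr₁⟩ := h q₁ (klfs_fst4_halfpi_points hμ₁ hμ₂ 1 (Or.inl rfl))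
  obtain ⟨γ₂, hγ₂, hr₂⟩ := h q₂ (klfs_fst4_halfpi_points hμ₁ hμ₂ (-1) (Or.inr rfl))
  simp only [FermiRG.FST4.LatticeData.fund₂, mem_inter_iff, mem_preimage] at hr₁ hr₂
  rw [hL] at hγ₁ hγ₂ hF
  -- the doubled representatives differ by a non-zero lattice vector
  have hdiff : (2 : ℝ) • (q₁ + γ₁) - (2 : ℝ) • (q₂ + γ₂) ∈ ((FermiRG.Crystal.cubic 2).dualLattice : Set Momentum) := by
    have hq : (2 : ℝ) • (q₁ + γ₁) - (2 : ℝ) • (q₂ + γ₂) =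
        (WithLp.toLp 2 ![2 * π, 0] : Momentum) + (γ₁ + γ₁) - (γ₂ + γ₂) := by
      ext j; fin_cases j <;> simp [hq₁, hq₂] <;> ring
    rw [hq]
    exact Submodule.sub_mem _ (Submodule.add_mem _ klfs_two_pi_e0_mem_dualLattice
      (Submodule.add_mem _ hγ₁ hγ₁)) (Submodule.add_mem _ hγ₂ hγ₂)
  have heq := hF _ hr₁.2 _ hr₂.2 hdiff
  have h0 := congrArg (fun v : Momentum => v 0) heq
  have h0' : 2 * (π / 2) + 2 * γ₁ 0 = -(2 * (π / 2)) + 2 * γ₂ 0 := by simpa [hq₁, hq₂] using h0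
  obtain ⟨n₁, hn₁⟩ := klfs_dualLattice_coord hγ₁ 0
  obtain ⟨n₂, hn₂⟩ := klfs_dualLattice_coord hγ₂ 0
  rw [hn₁, hn₂] at h0'
  have hreal : (1 : ℝ) = 2 * ((n₂ : ℝ) - n₁) := by
    have hπ : π ≠ 0 := Real.pi_ne_zero
    field_simp at h0'
    nlinarith [Real.pi_pos, h0']
  have hint : (1 : ℤ) = 2 * (n₂ - n₁) := by exact_mod_cast hreal
  omega


/-- **Hence `E = ε - μ ∉ 𝓔(δ₀, g₀, G₀, w₀)` for `-2 ≤ μ < 0`**, for every fundamental cell of `2πℤ²` and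
all constants: the typed class of the FST inversion theorem excludes the Hubbard band above `μ = -2`
(clause (i) of `FST4.InDispersionClass`). [folklore] -/
theorem klfs_fst4_not_inDispersionClass {μ : ℝ} (hμ₁ : -2 ≤ μ) (hμ₂ : μ < 0) (L : FermiRG.FST4.LatticeData 2)
    (hL : L.latt = ((FermiRG.Crystal.cubic 2).dualLattice : Set Momentum))
    (hF : ∀ z ∈ L.fund, ∀ w ∈ L.fund, z - w ∈ L.latt → z = w) (δ₀ g₀ G₀ w₀ : ℝ) :
    ¬ FermiRG.FST4.InDispersionClass L δ₀ g₀ G₀ w₀ (fun p : Momentum => squareDispersion 1 0 p - μ) :=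
  fun h => klfs_fst4_not_subset_fund₂ hμ₁ hμ₂ L hL hF h.2.1

/-- The OPEN cell `(-π, π)²` (FST IV p.4: «if `Γ = ℤ^d` … we may choose `𝓕 = (-π,π)^d`») is a set of
unique representatives: two of its points differing by a vector of `2πℤ²` are equal. [folklore] -/
theorem klfs_openCell_eq_of_sub_mem {z w : Momentum} (hz : ∀ i, |z i| < π) (hw : ∀ i, |w i| < π)
    (hzw : z - w ∈ (FermiRG.Crystal.cubic 2).dualLattice) : z = w := by
  ext i
  obtain ⟨n, hn⟩ := klfs_dualLattice_coord hzw i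
  rw [PiLp.sub_apply] at hn
  have hzi := abs_lt.1 (hz i)
  have hwi := abs_lt.1 (hw i)
  have hn1 : (n : ℝ) < 1 := by
    by_contra hc; push Not at hc; nlinarith [Real.pi_pos]
  have hn2 : (-1 : ℝ) < n := by
    by_contra hc; push Not at hc; nlinarith [Real.pi_pos]
  have hn0 : n = 0 := by
    have h1 : n < 1 := by exact_mod_cast hn1
    have h2 : -1 < n := by exact_mod_cast hn2
    omega
  rw [hn0] at hn
  simp at hn
  linarith

/-- **Cell of record 1 — the open cell `(-π,π)²` of FST IV**: for `-2 ≤ μ < 0` the Hubbard band is not in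
`𝓔(δ₀,g₀,G₀,w₀)` for `L = (2πℤ², (-π,π)²)`, whatever the constants. [folklore] -/
theorem klfs_fst4_not_inDispersionClass_openCell {μ : ℝ} (hμ₁ : -2 ≤ μ) (hμ₂ : μ < 0)
    (L : FermiRG.FST4.LatticeData 2) (hL : L.latt = ((FermiRG.Crystal.cubic 2).dualLattice : Set Momentum))
    (hFo : L.fund = {p : Momentum | ∀ i, |p i| < π}) (δ₀ g₀ G₀ w₀ : ℝ) :
    ¬ FermiRG.FST4.InDispersionClass L δ₀ g₀ G₀ w₀ (fun p : Momentum => squareDispersion 1 0 p - μ) := by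
  refine klfs_fst4_not_inDispersionClass hμ₁ hμ₂ L hL (fun z hz w hw hzw => ?_) δ₀ g₀ G₀ w₀
  rw [hFo] at hz hw
  rw [hL] at hzw
  exact klfs_openCell_eq_of_sub_mem hz hw hzw

/-- **Cell of record 2 — the half-open cell `[-π,π)²` of `FermiRG.Crystal.cubic 2`** (the datum of the
FST II/III instantiation files): same conclusion. [folklore] -/
theorem klfs_fst4_not_inDispersionClass_crystalCell {μ : ℝ} (hμ₁ : -2 ≤ μ) (hμ₂ : μ < 0)
    (L : FermiRG.FST4.LatticeData 2) (hL : L.latt = ((FermiRG.Crystal.cubic 2).dualLattice : Set Momentum))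
    (hFc : L.fund = (FermiRG.Crystal.cubic 2).fundamentalDomain) (δ₀ g₀ G₀ w₀ : ℝ) :
    ¬ FermiRG.FST4.InDispersionClass L δ₀ g₀ G₀ w₀ (fun p : Momentum => squareDispersion 1 0 p - μ) := by
  refine klfs_fst4_not_inDispersionClass hμ₁ hμ₂ L hL (fun z hz w hw hzw => ?_) δ₀ g₀ G₀ w₀
  rw [hFc] at hz hw
  rw [hL] at hzw
  exact (FermiRG.Crystal.cubic 2).eq_of_sub_mem_dualLattice hz hw hzw

/-- **On both programme windows** (`μ ∈ [-0.4267, -0.1798]` ⟸ `δ ∈ [0.10, 0.20]`; analysis window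
`μ ∈ [-1, -0.15]`) the Hubbard band is outside FST IV's class `𝓔(δ₀,g₀,G₀,w₀)` for every fundamental cell and
all constants: the typed inversion theorem `FST4.theorem1` is not instantiable there (umklapp).
[folklore] -/
theorem klfs_windows_fst4_not_inDispersionClass {μ : ℝ}
    (hμ : μ ∈ Icc (-0.4267 : ℝ) (-0.1798) ∨ μ ∈ Icc (-1 : ℝ) (-0.15)) (L : FermiRG.FST4.LatticeData 2)
    (hL : L.latt = ((FermiRG.Crystal.cubic 2).dualLattice : Set Momentum))
    (hF : ∀ z ∈ L.fund, ∀ w ∈ L.fund, z - w ∈ L.latt → z = w) (δ₀ g₀ G₀ w₀ : ℝ) :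
    ¬ FermiRG.FST4.InDispersionClass L δ₀ g₀ G₀ w₀ (fun p : Momentum => squareDispersion 1 0 p - μ) := by
  rcases hμ with ⟨h1, h2⟩ | ⟨h1, h2⟩
  · exact klfs_fst4_not_inDispersionClass (by linarith) (by linarith) L hL hF δ₀ g₀ G₀ w₀
  · exact klfs_fst4_not_inDispersionClass (by linarith) (by linarith) L hL hF δ₀ g₀ G₀ w₀

end Summit.HubbardSuperconductivity.HubbardSuperconductivity.Theorems

end
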